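import Summits.AtomisticToContinuum.Crystallization.Theses.GappedShellCensus
import Literature.Geometry.DiscreteGeometry.DihedralAngleFraction

/-!
# Half-quad corner bound about a spoke of a gapped shell

Worker lemma `stub_hCornerMax` of the crux `GappedShellCensus.ShellTrichotomy`
(line `Sketch`, census half).

Let `v a x : ℝ³` have norms in `[0.98, 1.02]`, let `va` and `ax` be bonds (distance in
`[0.98, 1.02]`) and let `vx` be far (`dist v x ≥ 1.26`).  Then the dihedral angle about the spoke
`0v` between the half-planes through `a` and through `x`, i.e. the angle between the components
`perpTo v a`, `perpTo v x` of `a`, `x` orthogonal to `v`, is at most `arccos (807/2000) ≈ 66.2°`.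

Proof.  Write `X = ⟪v,a⟫/(‖v‖‖a‖)`, `Y = ⟪v,x⟫/(‖v‖‖x‖)`, `Z = ⟪a,x⟫/(‖a‖‖x‖)` for the cosines
of the three central angles.  The Gram data of the projections are
`‖perpTo v a‖² = ‖a‖² (1 − X²)`, `‖perpTo v x‖² = ‖x‖² (1 − Y²)`,
`⟪perpTo v a, perpTo v x⟫ = ‖a‖ ‖x‖ (Z − X Y)`, so the cosine of the dihedral angle is
`(Z − XY)/√((1 − X²)(1 − Y²))` (spherical law of cosines).  Polarisation and the metric
hypotheses give the windows `X ∈ [2201/4802, 2801/5202]`, `Y ≤ 1233/5202`, `Z ≥ 2201/4802`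
(the radii couple numerator and denominator; the extreme values sit at corners of the radius
box), and on this region `(Z − XY)² ≥ (807/2000)² (1 − X²)(1 − Y²)` with `Z − XY > 0`:
the left side decreases as `Z ↓ 2201/4802` and as `Y ↑ 1233/5202` (a two-point polynomial
identity), and at these extreme values the claim is a quadratic in `X` with negative
discriminant.  Cauchy–Schwarz for the two projections shows `Y² < 1`, so both projections are
non-zero and `arccos` is antitone.
-/

noncomputable section

namespace Summit.AtomisticToContinuum.Crystallization.Theorems

open scoped RealInnerProductSpace
open Literature.Geometry.DiscreteGeometry

/-- Lower window for the cosine of a bond angle at the origin: if `‖u‖, ‖w‖ ∈ [0.98, 1.02]` and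
`‖u − w‖ ≤ 1.02` then `⟪u, w⟫ ≥ (2201/4802) ‖u‖ ‖w‖` (polarisation; the extreme case is
`‖u‖ = ‖w‖ = 0.98`, `‖u − w‖ = 1.02`). -/
private lemma hCornerMax_cos_lower {u w : EuclideanSpace ℝ (Fin 3)}
    (hu : 1 - 1 / 50 ≤ ‖u‖ ∧ ‖u‖ ≤ 1 + 1 / 50) (hw : 1 - 1 / 50 ≤ ‖w‖ ∧ ‖w‖ ≤ 1 + 1 / 50)
    (huw : dist u w ≤ 1 + 1 / 50) :
    2201 / 4802 * (‖u‖ * ‖w‖) ≤ ⟪u, w⟫ := by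
  rw [dist_eq_norm] at huw
  have h := norm_sub_sq_real u w
  have hd : ‖u - w‖ ^ 2 ≤ (1 + 1 / 50) ^ 2 := pow_le_pow_left₀ (norm_nonneg _) huw 2
  nlinarith [sq_nonneg (‖u‖ - ‖w‖), mul_nonneg (sub_nonneg.2 hu.1) (sub_nonneg.2 hw.1)]

/-- Upper window for the cosine of a bond angle at the origin: if `‖u‖, ‖w‖ ∈ [0.98, 1.02]` and
`‖u − w‖ ≥ 0.98` then `⟪u, w⟫ ≤ (2801/5202) ‖u‖ ‖w‖` (extreme case `‖u‖ = ‖w‖ = 1.02`,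
`‖u − w‖ = 0.98`). -/
private lemma hCornerMax_cos_upper {u w : EuclideanSpace ℝ (Fin 3)}
    (hu : 1 - 1 / 50 ≤ ‖u‖ ∧ ‖u‖ ≤ 1 + 1 / 50) (hw : 1 - 1 / 50 ≤ ‖w‖ ∧ ‖w‖ ≤ 1 + 1 / 50)
    (huw : 1 - 1 / 50 ≤ dist u w) :
    ⟪u, w⟫ ≤ 2801 / 5202 * (‖u‖ * ‖w‖) := by
  rw [dist_eq_norm] at huw
  have h := norm_sub_sq_real u w
  have hd : (1 - 1 / 50) ^ 2 ≤ ‖u - w‖ ^ 2 := pow_le_pow_left₀ (by norm_num) huw 2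
  nlinarith [mul_nonneg (sub_nonneg.2 hu.2) (sub_nonneg.2 hw.2),
    mul_nonneg (sub_nonneg.2 hu.1) (sub_nonneg.2 hu.2),
    mul_nonneg (sub_nonneg.2 hw.1) (sub_nonneg.2 hw.2)]

/-- Upper window for the cosine of a far angle at the origin: if `‖u‖, ‖w‖ ∈ [0.98, 1.02]` and
`‖u − w‖ ≥ 1.26` then `⟪u, w⟫ ≤ (1233/5202) ‖u‖ ‖w‖` (extreme case `‖u‖ = ‖w‖ = 1.02`,
`‖u − w‖ = 1.26`). -/
private lemma hCornerMax_cos_far {u w : EuclideanSpace ℝ (Fin 3)}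
    (hu : 1 - 1 / 50 ≤ ‖u‖ ∧ ‖u‖ ≤ 1 + 1 / 50) (hw : 1 - 1 / 50 ≤ ‖w‖ ∧ ‖w‖ ≤ 1 + 1 / 50)
    (huw : 63 / 50 ≤ dist u w) :
    ⟪u, w⟫ ≤ 1233 / 5202 * (‖u‖ * ‖w‖) := by
  rw [dist_eq_norm] at huw
  have h := norm_sub_sq_real u w
  have hd : (63 / 50 : ℝ) ^ 2 ≤ ‖u - w‖ ^ 2 := pow_le_pow_left₀ (by norm_num) huw 2
  nlinarith [mul_nonneg (sub_nonneg.2 hu.2) (sub_nonneg.2 hw.2),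
    mul_nonneg (sub_nonneg.2 hu.1) (sub_nonneg.2 hu.2),
    mul_nonneg (sub_nonneg.2 hw.1) (sub_nonneg.2 hw.2)]

/-- Squared norm of the component of `b` orthogonal to `e ≠ 0` in terms of the cosine `X` of the
central angle: `‖perpTo e b‖² = ‖b‖² (1 − X²)`. -/
private lemma hCornerMax_inner_pp {e b : EuclideanSpace ℝ (Fin 3)} (he : e ≠ 0) {X : ℝ}
    (hX : ⟪e, b⟫ = X * (‖e‖ * ‖b‖)) :
    ⟪perpTo e b, perpTo e b⟫ = ‖b‖ ^ 2 * (1 - X ^ 2) := by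
  have he' : ‖e‖ ≠ 0 := norm_ne_zero_iff.2 he
  rw [inner_perpTo_self he, real_inner_self_eq_norm_sq, real_inner_self_eq_norm_sq, hX]
  field_simp

/-- Inner product of the components of `b`, `c` orthogonal to `e ≠ 0` in terms of the cosines
`X, Y, Z` of the central angles `(e,b)`, `(e,c)`, `(b,c)`:
`⟪perpTo e b, perpTo e c⟫ = ‖b‖ ‖c‖ (Z − X Y)`. -/
private lemma hCornerMax_inner_pq {e b c : EuclideanSpace ℝ (Fin 3)} (he : e ≠ 0) {X Y Z : ℝ}
    (hX : ⟪e, b⟫ = X * (‖e‖ * ‖b‖)) (hY : ⟪e, c⟫ = Y * (‖e‖ * ‖c‖))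
    (hZ : ⟪b, c⟫ = Z * (‖b‖ * ‖c‖)) :
    ⟪perpTo e b, perpTo e c⟫ = ‖b‖ * ‖c‖ * (Z - X * Y) := by
  have he' : ‖e‖ ≠ 0 := norm_ne_zero_iff.2 he
  -- adapted from `inner_perpTo_perpTo_eq` (SquareWellLayerCakeAveragedTwelveQrRange)
  have h1 : ⟪perpTo e b, perpTo e c⟫ = ⟪perpTo e b, c⟫ := by
    rw [perpTo_def e c, inner_sub_right, real_inner_smul_right, inner_perpTo_left, mul_zero,
      sub_zero]
  rw [h1, perpTo_def, inner_sub_left, real_inner_smul_left, real_inner_self_eq_norm_sq, hX, hY, hZ]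
  field_simp

/-- Positivity of the numerator `Z − X Y` of the dihedral cosine on the window. -/
private lemma hCornerMax_pos {X Y Z : ℝ} (hX0 : 2201 / 4802 ≤ X) (hX1 : X ≤ 2801 / 5202)
    (hY1 : Y ≤ 1233 / 5202) (hZ0 : 2201 / 4802 ≤ Z) : 0 < Z - X * Y := by
  nlinarith [mul_nonneg (show (0 : ℝ) ≤ X by linarith) (sub_nonneg.2 hY1)]

/-- The real-variable heart: on the window `X ∈ [2201/4802, 2801/5202]`, `Y ≤ 1233/5202`,
`Y² ≤ 1`, `Z ≥ 2201/4802` one has `(807/2000)² (1 − X²)(1 − Y²) ≤ (Z − X Y)²`.  Reduction to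
`Z = 2201/4802` (monotone numerator), then to `Y = 1233/5202` (a two-point identity in `Y`), then
a quadratic in `X` with negative discriminant. -/
private lemma hCornerMax_key {X Y Z : ℝ} (hX0 : 2201 / 4802 ≤ X) (hX1 : X ≤ 2801 / 5202)
    (hY1 : Y ≤ 1233 / 5202) (hY2 : Y ^ 2 ≤ 1) (hZ0 : 2201 / 4802 ≤ Z) :
    (807 / 2000) ^ 2 * ((1 - X ^ 2) * (1 - Y ^ 2)) ≤ (Z - X * Y) ^ 2 := by
  have hXY : 0 ≤ 2201 / 4802 - X * Y := by
    nlinarith [mul_nonneg (show (0 : ℝ) ≤ X by linarith) (sub_nonneg.2 hY1)]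
  -- step 1: decrease `Z` to its lower end
  have h1 : (2201 / 4802 - X * Y) ^ 2 ≤ (Z - X * Y) ^ 2 :=
    pow_le_pow_left₀ hXY (by linarith) 2
  -- step 2: increase `Y` to its upper end (two-point identity, factoring through `1233/5202 − Y`)
  have h2 : (2201 / 4802 - X * (1233 / 5202)) ^ 2 * (1 - Y ^ 2) ≤
      (2201 / 4802 - X * Y) ^ 2 * (1 - (1233 / 5202 : ℝ) ^ 2) := by
    nlinarith [mul_nonneg (mul_nonneg (sub_nonneg.2 hY1)
        (show (0 : ℝ) ≤ 2201 / 4802 - 1233 / 5202 * X by linarith))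
        (show (0 : ℝ) ≤ X - 1233 / 5202 * (2201 / 4802) by linarith),
      mul_nonneg (sq_nonneg (1233 / 5202 - Y))
        (add_nonneg (mul_nonneg (sq_nonneg X) (show (0 : ℝ) ≤ 1 - (1233 / 5202) ^ 2 by norm_num))
          (sq_nonneg (2201 / 4802 - X * (1233 / 5202))))]
  -- step 3: the endpoint quadratic in `X` (negative discriminant; vertex near `13/25`)
  have h3 : (807 / 2000 : ℝ) ^ 2 * (1 - X ^ 2) * (1 - (1233 / 5202 : ℝ) ^ 2) ≤
      (2201 / 4802 - X * (1233 / 5202)) ^ 2 := by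
    nlinarith [sq_nonneg (X - 13 / 25)]
  have h4 : (807 / 2000 : ℝ) ^ 2 * (1 - X ^ 2) * (1 - (1233 / 5202 : ℝ) ^ 2) * (1 - Y ^ 2) ≤
      (2201 / 4802 - X * (1233 / 5202)) ^ 2 * (1 - Y ^ 2) :=
    mul_le_mul_of_nonneg_right h3 (by linarith)
  have h5 : (807 / 2000 : ℝ) ^ 2 * ((1 - X ^ 2) * (1 - Y ^ 2)) * (1 - (1233 / 5202 : ℝ) ^ 2) ≤
      (Z - X * Y) ^ 2 * (1 - (1233 / 5202 : ℝ) ^ 2) := by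
    nlinarith [h1, h2, h4]
  exact le_of_mul_le_mul_right h5 (by norm_num)

/-- **Half-quad corner bound (coupled).** About the spoke `0v` of a gapped shell, the dihedral
angle from a bonded neighbour `a` of `v` to a far point `x` (`dist v x ≥ 1.26`) bonded to `a` is
at most `arccos (807/2000) ≈ 66.2°`: with `X, Y, Z` the cosines of the central angles `(v,a)`,
`(v,x)`, `(a,x)`, the dihedral cosine is `(Z − XY)/√((1 − X²)(1 − Y²)) ≥ 807/2000` on the metric
window. -/
theorem stub_hCornerMax (v a x : EuclideanSpace ℝ (Fin 3))
    (hv : 1 - 1 / 50 ≤ ‖v‖ ∧ ‖v‖ ≤ 1 + 1 / 50) (ha : 1 - 1 / 50 ≤ ‖a‖ ∧ ‖a‖ ≤ 1 + 1 / 50)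
    (hx : 1 - 1 / 50 ≤ ‖x‖ ∧ ‖x‖ ≤ 1 + 1 / 50)
    (hva : 1 - 1 / 50 ≤ dist v a ∧ dist v a ≤ 1 + 1 / 50) (hax : 1 - 1 / 50 ≤ dist a x ∧ dist a x ≤ 1 + 1 / 50)
    (hvx : 63 / 50 ≤ dist v x) :
    InnerProductGeometry.angle (perpTo v a) (perpTo v x) ≤ Real.arccos (807 / 2000) := by
  have hv0 : 0 < ‖v‖ := by linarith [hv.1]
  have ha0 : 0 < ‖a‖ := by linarith [ha.1]
  have hx0 : 0 < ‖x‖ := by linarith [hx.1]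
  have hvne : v ≠ 0 := norm_pos_iff.1 hv0
  -- the cosines of the three central angles
  obtain ⟨X, hXd⟩ : ∃ X : ℝ, ⟪v, a⟫ = X * (‖v‖ * ‖a‖) :=
    ⟨⟪v, a⟫ / (‖v‖ * ‖a‖), (div_mul_cancel₀ _ (mul_pos hv0 ha0).ne').symm⟩
  obtain ⟨Y, hYd⟩ : ∃ Y : ℝ, ⟪v, x⟫ = Y * (‖v‖ * ‖x‖) :=
    ⟨⟪v, x⟫ / (‖v‖ * ‖x‖), (div_mul_cancel₀ _ (mul_pos hv0 hx0).ne').symm⟩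
  obtain ⟨Z, hZd⟩ : ∃ Z : ℝ, ⟪a, x⟫ = Z * (‖a‖ * ‖x‖) :=
    ⟨⟪a, x⟫ / (‖a‖ * ‖x‖), (div_mul_cancel₀ _ (mul_pos ha0 hx0).ne').symm⟩
  -- the metric windows
  have hX0 : 2201 / 4802 ≤ X :=
    le_of_mul_le_mul_right (hXd ▸ hCornerMax_cos_lower hv ha hva.2) (mul_pos hv0 ha0)
  have hX1 : X ≤ 2801 / 5202 :=
    le_of_mul_le_mul_right (hXd ▸ hCornerMax_cos_upper hv ha hva.1) (mul_pos hv0 ha0)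
  have hY1 : Y ≤ 1233 / 5202 :=
    le_of_mul_le_mul_right (hYd ▸ hCornerMax_cos_far hv hx hvx) (mul_pos hv0 hx0)
  have hZ0 : 2201 / 4802 ≤ Z :=
    le_of_mul_le_mul_right (hZd ▸ hCornerMax_cos_lower ha hx hax.2) (mul_pos ha0 hx0)
  clear hva hax hvx
  -- Gram data of the two projections
  have hpp := hCornerMax_inner_pp hvne hXd
  have hqq := hCornerMax_inner_pp hvne hYd
  have hpq := hCornerMax_inner_pq hvne hXd hYd hZd
  have hpos : 0 < Z - X * Y := hCornerMax_pos hX0 hX1 hY1 hZ0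
  have hX2 : X ^ 2 < 1 := by nlinarith
  -- Cauchy–Schwarz for the projections: `(Z − XY)² ≤ (1 − X²)(1 − Y²)`, hence `Y² < 1`
  have hcs : (Z - X * Y) ^ 2 ≤ (1 - X ^ 2) * (1 - Y ^ 2) := by
    have h := real_inner_mul_inner_self_le (perpTo v a) (perpTo v x)
    rw [hpp, hqq, hpq] at h
    have h' : ‖a‖ ^ 2 * ‖x‖ ^ 2 * (Z - X * Y) ^ 2 ≤
        ‖a‖ ^ 2 * ‖x‖ ^ 2 * ((1 - X ^ 2) * (1 - Y ^ 2)) := by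
      calc ‖a‖ ^ 2 * ‖x‖ ^ 2 * (Z - X * Y) ^ 2
          = ‖a‖ * ‖x‖ * (Z - X * Y) * (‖a‖ * ‖x‖ * (Z - X * Y)) := by ring
        _ ≤ ‖a‖ ^ 2 * (1 - X ^ 2) * (‖x‖ ^ 2 * (1 - Y ^ 2)) := h
        _ = ‖a‖ ^ 2 * ‖x‖ ^ 2 * ((1 - X ^ 2) * (1 - Y ^ 2)) := by ring
    exact le_of_mul_le_mul_left h' (by positivity)
  have hY2 : Y ^ 2 < 1 := by
    by_contra hcon
    have h1 : (1 - X ^ 2) * (1 - Y ^ 2) ≤ 0 :=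
      mul_nonpos_iff.2 (Or.inl ⟨by linarith, by linarith [not_lt.1 hcon]⟩)
    nlinarith [pow_pos hpos 2]
  have hkey := hCornerMax_key hX0 hX1 hY1 hY2.le hZ0
  -- both projections are non-zero, the planar inner product is positive
  have hpp0 : 0 < ⟪perpTo v a, perpTo v a⟫ := by
    rw [hpp]; exact mul_pos (pow_pos ha0 2) (by linarith)
  have hqq0 : 0 < ⟪perpTo v x, perpTo v x⟫ := by
    rw [hqq]; exact mul_pos (pow_pos hx0 2) (by linarith)
  have hp0 : 0 < ‖perpTo v a‖ := norm_pos_iff.2 (real_inner_self_pos.1 hpp0)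
  have hq0 : 0 < ‖perpTo v x‖ := norm_pos_iff.2 (real_inner_self_pos.1 hqq0)
  have hpq0 : 0 < ⟪perpTo v a, perpTo v x⟫ := by
    rw [hpq]; exact mul_pos (mul_pos ha0 hx0) hpos
  -- `(807/2000) ‖p‖ ‖q‖ ≤ ⟪p, q⟫` by comparing squares
  have hsq : (807 / 2000 * (‖perpTo v a‖ * ‖perpTo v x‖)) ^ 2 ≤ ⟪perpTo v a, perpTo v x⟫ ^ 2 := by
    rw [mul_pow, mul_pow, ← real_inner_self_eq_norm_sq, ← real_inner_self_eq_norm_sq, hpp, hqq,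
      hpq]
    have h := mul_le_mul_of_nonneg_left hkey (by positivity : (0 : ℝ) ≤ ‖a‖ ^ 2 * ‖x‖ ^ 2)
    calc (807 / 2000 : ℝ) ^ 2 * (‖a‖ ^ 2 * (1 - X ^ 2) * (‖x‖ ^ 2 * (1 - Y ^ 2)))
        = ‖a‖ ^ 2 * ‖x‖ ^ 2 * ((807 / 2000) ^ 2 * ((1 - X ^ 2) * (1 - Y ^ 2))) := by ring
      _ ≤ ‖a‖ ^ 2 * ‖x‖ ^ 2 * (Z - X * Y) ^ 2 := h
      _ = (‖a‖ * ‖x‖ * (Z - X * Y)) ^ 2 := by ring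
  have hle : 807 / 2000 * (‖perpTo v a‖ * ‖perpTo v x‖) ≤ ⟪perpTo v a, perpTo v x⟫ :=
    le_of_pow_le_pow_left₀ two_ne_zero hpq0.le hsq
  unfold InnerProductGeometry.angle
  exact Real.arccos_le_arccos ((le_div_iff₀ (mul_pos hp0 hq0)).2 hle)

end Summit.AtomisticToContinuum.Crystallization.Theorems
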